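import Summits.BirchSwinnertonDyer.BirchSwinnertonDyer.Theorems.PrintX11aNonSurjEulerHalfOfMu
import Summits.BirchSwinnertonDyer.BirchSwinnertonDyer.Theorems.PrintX11aNonSurjMuAnHardDefs
import Summits.BirchSwinnertonDyer.BirchSwinnertonDyer.Theorems.PrintX11aUpperNonSurjThreeMuAnHardThreeOfMazur
import HarnessLib

/-!
# Route `PrintX11a`, child crux U3 = `PrintX11a.UpperNonSurjThree` (item stmt-BirchSwinnertonDyer-20613): **the crux from K2's
# published-fact bundle ALONE** — `KatoTwinFactsFiveAn → UpperNonSurjThree`, sorry-free, CONDITIONAL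
# (cell `bsd-print-x11a`, LEAD seat `bsd-line-x11a-p1` g0 of line «finemu3», D-0154 row 11; `--supports stmt-BirchSwinnertonDyer-20613`)

HONEST FRAMING.  BSD is not proved by any of this; nothing is asserted about any curve.  ONE theorem, no definition, no named
fact minted, no `sorry`.  It is CONDITIONAL: its hypothesis is the route decl `Theses.ErratumRoadFive.KatoTwinFactsFiveAn`
(= bsd-stepL's support item stmt-BirchSwinnertonDyer-19949), the conjunction of twenty-three statement-only named PUBLISHED
facts (Gross–Zagier, Kolyvagin, Wuthrich Prop. 21, GZK, modularity ×3, Friedberg–Hoffstein, Mazur's Manin constant (Mazur 1978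
Cor. 4.1), Gross / singular moduli, Stein–Wuthrich Thm. 6.1 ×2, Greenberg–Stevens, Cha Rmk. 25 ×2, Kato (12.2.1)/Thm. 12.4, Kato
§17.13 CONSTRUCTION facts at a non-split / split multiplicative `p` and with the fine quotient (flags `Kato-17.11-at-{nonsplit,split}-mult`,
`Kato-p280-image-at-mult`, rider R-48), Greenberg 1999 Thm. 1.5, Wuthrich 2014 Cor. 18); the item 20613 does NOT close by this
file (its own signature is not proved: the bundle's conjuncts have no `_holds`).  The gate records a `conditional-result`.

WHAT.  `upperNonSurjThree_of_katoTwinFactsFiveAn : KatoTwinFactsFiveAn → UpperNonSurjThree` — at every X11a pair with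
`ρ̄_{E,3}` not surjective (`3 ∥ N`, images `3Ns`/`3Nn`), `ord₃ #Ш(E) ≤ ord₃ #Ш(E)_an`, from the bundle.  It is the μ-ROAD of
the registered line «finemu3» (= «hardlocus3») with its ONLY non-fact stub DISCHARGED: the analytic certificate
`Theorems.X11aNonSurjMuAnHardThree` is width seat bsd-line-x11a-p2 g2's THEOREM `MultThreeMuAn.x11aNonSurjMuAnHardThree_of_mazur`
(p614543 — Greenberg's analytic μ₃ = 0 at a MULTIPLICATIVE 3 for every `E/ℚ` with irreducible `E[3]`, by an Atkin–Lehner-extended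
orbit trick in `GL₂(ℤ[1/3])` (p611923/p612677/p613210), the Manin calculus at `W₃` (p612678) and the winding theorem (p613999),
modulo Mazur's Manin-constant fact = conjunct 9 of the bundle); then, per split type, the K2/ty2 engine
`X11b.multDivisibilityAt_of_katoFacts_of_muAn` (Kato μ-transfer at `p ∥ N` without big image) and the door
`X11b.missingUpperBoundAt_of_classX11a_of_multDivisibilityAt`, or — at a non-split pair with a unit special value — the landed
`Theorems.x11a_missingUpperBoundAt_of_not_surj_of_nonsplit_of_unit_value`.  Verbatim the composition
`UpperNonSurjThree_of_pubFacts` of `Cruxes/UpperNonSurjThree/Lines/finemu3.lean` r4.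

READING (for the planner): crux U3 is now EXACTLY «K2's bundle 19949» in the kernel — the same residual as every other
consumer of the Kato §17.13 construction facts; whether to re-split 20613 as glue «19949 → U3» (this theorem) + the shared
child 19949, or to keep it open-modulo-facts, is the planner's call.  beyond-print theorem: the μ₃ input (p614543) is NOT in
print (Greenberg LNM 1716 Conj. 1.11 at p = 3, multiplicative, irreducible); this file adds no mathematics to it.

References: [GreenbergLNM1716] §1 Conj. 1.11; [Kato2004Asterisque] Thm. 12.4 (p. 221), §17.13 (pp. 279–280);
[Wuthrich2014] Cor. 18 (p. 398); [SteinWuthrich2013] Thm. 6.1 (p. 20); [Mazur1978] Cor. 4.1; [MazurTateTeitelbaum1986Invent] §I.10;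
tree `Theorems/PrintX11aUpperNonSurjThreeMuAnHardThreeOfMazur.lean` (x11a-p2 g2), `Theorems/PrintX11aNonSurjEulerHalfOfMu.lean`,
`Theorems/ErratumRoadFiveNonSurjCornerBranchesAn.lean`, `Cruxes/UpperNonSurjThree/Lines/finemu3.lean`.
-/

set_option linter.dupNamespace false
set_option autoImplicit false

noncomputable section

open scoped Classical NumberField MatrixGroups ModularForm

open CongruenceSubgroup WeierstrassCurve Field
  Literature.NumberTheory.EllipticCurves
  Literature.NumberTheory.EllipticCurves.ModularForms
  Literature.NumberTheory.EllipticCurves.Rank1Residual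
  Literature.NumberTheory.EllipticCurves.Rank1Residual.Typed
  Literature.NumberTheory.EllipticCurves.Wuthrich2014
  Literature.NumberTheory.EllipticCurves.SteinWuthrich2013
  Literature.NumberTheory.EllipticCurves.Greenberg1999
  Literature.NumberTheory.EllipticCurves.Kato2004
  Summit.BirchSwinnertonDyer.Rank1Residual
  Summit.BirchSwinnertonDyer.Rank1Residual.X11b
  Summit.BirchSwinnertonDyer.BirchSwinnertonDyer

namespace Summit.BirchSwinnertonDyer.BirchSwinnertonDyer.Theorems

/-- **Crux U3 `PrintX11a.UpperNonSurjThree` from K2's published-fact bundle `KatoTwinFactsFiveAn` ALONE** (sorry-free,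
CONDITIONAL on the twenty-three named facts; closes nothing by itself): at every X11a pair with `ρ̄_{E,3}` not surjective,
`ord₃ #Ш(E) ≤ ord₃ #Ш(E)_an`.  μ-road of line «finemu3» with the analytic certificate supplied by
`MultThreeMuAn.x11aNonSurjMuAnHardThree_of_mazur` (Greenberg's analytic μ₃ = 0 at a multiplicative 3, irreducible `E[3]`),
fed Mazur's Manin-constant fact (conjunct 9); transfer `X11b.multDivisibilityAt_of_katoFacts_of_muAn`; door
`X11b.missingUpperBoundAt_of_classX11a_of_multDivisibilityAt`; unit-value non-split pairs by
`Theorems.x11a_missingUpperBoundAt_of_not_surj_of_nonsplit_of_unit_value`.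
[cite: GreenbergLNM1716, §1 Conj. 1.11 (p. 62)] [cite: Kato2004Asterisque, Thm. 12.4 (p. 221) and §17.13 (pp. 279–280)]
[cite: SteinWuthrich2013, Thm. 6.1 (p. 20)] [cite: Mazur1978, Cor. 4.1] [cite: Wuthrich2014, Cor. 18 (p. 398)] -/
theorem upperNonSurjThree_of_katoTwinFactsFiveAn (hF : Theses.ErratumRoadFive.KatoTwinFactsFiveAn) :
    Theses.PrintX11a.UpperNonSurjThree := by
  obtain ⟨-, -, -, hGZK, hmod, -, hpar, -, hM, -, -, hJs, hJn, hGS, -, -, hne, h12, hnsI, hspI, h15, h18,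
    hfine⟩ := hF
  have hμ : Theorems.X11aNonSurjMuAnHardThree := MultThreeMuAn.x11aNonSurjMuAnHardThree_of_mazur hM
  intro W _ _ p _ hX hns hp3
  have hp2 : p ≠ 2 := hX.2.1
  by_cases hsplit : W.HasSplitMultiplicativeReductionAtPrime p
  · exact missingUpperBoundAt_of_classX11a_of_multDivisibilityAt hJs hJn hGZK hmod hpar W p (hGS W p) hX
      (multDivisibilityAt_of_katoFacts_of_muAn hne h12 hnsI hspI h15 h18 hfine W p hp2 hX.2.2.1
        hX.2.2.2.1 hns (hμ W p hX hns hp3 (Or.inl hsplit)))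
  · by_cases hunit : ∃ t : ℚ, W.entireLFunction 1 / (W.realPeriodRat : ℂ) = (t : ℂ) ∧ padicValRat p t = 0
    · obtain ⟨t, ht, hu⟩ := hunit
      exact Theorems.x11a_missingUpperBoundAt_of_not_surj_of_nonsplit_of_unit_value hJs hJn hGZK hmod
        hpar hne h12 hnsI hspI h15 h18 hfine W p (hGS W p) hX hns hsplit t ht hu
    · have hhard : ∀ t : ℚ, W.entireLFunction 1 / (W.realPeriodRat : ℂ) = (t : ℂ) →
          padicValRat p t ≠ 0 := fun t ht hu => hunit ⟨t, ht, hu⟩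
      exact missingUpperBoundAt_of_classX11a_of_multDivisibilityAt hJs hJn hGZK hmod hpar W p (hGS W p)
        hX (multDivisibilityAt_of_katoFacts_of_muAn hne h12 hnsI hspI h15 h18 hfine W p hp2 hX.2.2.1
          hX.2.2.2.1 hns (hμ W p hX hns hp3 (Or.inr hhard)))

/-- **The same in the glue shape a planner's re-split would use**: `KatoTwinFactsFiveAn → UpperNonSurjThree`.
[cite: GreenbergLNM1716, §1 Conj. 1.11 (p. 62)] [cite: Kato2004Asterisque, §17.13 (pp. 279–280)] -/
theorem upperNonSurjThree_of_katoTwinFactsFiveAn_glue :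
    Theses.ErratumRoadFive.KatoTwinFactsFiveAn → Theses.PrintX11a.UpperNonSurjThree :=
  upperNonSurjThree_of_katoTwinFactsFiveAn

end Summit.BirchSwinnertonDyer.BirchSwinnertonDyer.Theorems

end
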